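import Mathlib
import Summits.ValiantsHypothesis.ValiantsHypothesis.Theorems.KPlusLogSqLawStepSupStructure

/-!
# The EVENT-PAIR PRINCIPLE and the CROSS LAW (static path model behind `KPlusLogSqLaw.TropicalB`)

Cell pub-symmetroid, seat conjb-2 (g22). A helper toward the crux `TropicalB`
(`Summit.ValiantsHypothesis.ValiantsHypothesis.Theses.KPlusLogSqLaw.TropicalB`, item
`stmt-ValiantsHypothesis-19771`); it earns no crux credit and is not evidence for `MatrixDescartes` or for
Valiant's hypothesis.

Setting as in `KPlusLogSqLawStepSupStructure`: lines `S_t(θ) = b t + s t * θ`, a class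
`up` of upper lines, windows `[u, v]` separated at `θ` iff every upper line of the window is strictly above every other
line of the window at `θ`, `T[u, v]` the separation set, rows of odd reach `d` that STEP (consecutive separation sets
non-empty, disjoint, ordered).

THE EVENT-PAIR PRINCIPLE (THEORY-NOTE-g22 §4). Every stepping row has two binding events (the leaving line binds at
the inner end of its first separation set — `step_sup_structure` —, the entering line at the inner end of the second);
at an event the window is weakly separated and the two marked lines are extreme in their classes. `two_point_sign`:
if two lines `x ≠ y` compare one way at an earlier event and the other way at a later one, against the order of their
slopes, the configuration is impossible. The continuation law C, the partner law Q (`KPlusLogSqLawStepPartner`) and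
the new laws below are all instances; the instances are indexed by the row distance of the two events.

THE CROSS LAW J1 (row distance 3, lines `i` and `i+3` of opposite classes; located as the k = 4 residue at reach 5 —
together with its companions it kills exactly the 576 order types that pass the seven earlier laws but are not
realisable — and proved for every odd reach `d ≥ 3`). Let rows `i`, `i+1`, `i+2` move to the right
(`T[i,i+d] < T[i+1,i+d+1] < T[i+2,i+d+2] < T[i+3,i+d+3]`) and let row `i+3` step (either direction), line `i`
upper. Then SOME admissible partner `p` of row `i` (other class, `i+1 ≤ p ≤ i+d`, `s i < s p < s (i+d+1)`) satisfies
`p ≤ i+3` or `s p < s (i+3)`. PROOF: at `r₀ = sup T[i,i+d]` the realised partner `p` is the top lower line of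
`[i, i+d]`, so `S_{i+3}(r₀) ≤ S_p(r₀)`; at the binding point `r₃` of the lower line `i+3` (sup or inf of
`T[i+3,i+d+3]`, `lower_leaving_event_right/left`) the line `i+3` is the top lower line of `[i+3, i+d+3]`, so
`S_p(r₃) ≤ S_{i+3}(r₃)` once `p ≥ i+4`; and `r₀ < r₃`. `two_point_sign` finishes. Statements: `cross_law_core`
(class-generic, abstract third event), `cross_law_even_same` / `cross_law_even_opp` (line `i` even, row `i+3` moving
right / left); the odd-`i` and mirror statements follow by `S ↦ -S` / `θ ↦ -θ` exactly as in
`KPlusLogSqLawStepPartner` and are not spelled out.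

The distance-4 member of the family, the FIVE-ROW SIGN LAW V, is in `KPlusLogSqLawStepEvents` /
`KPlusLogSqLawStepFive`.
-/

set_option linter.dupNamespace false

namespace Summit.ValiantsHypothesis.ValiantsHypothesis.Theorems.KPlusLogSqLawStepCross

open Summit.ValiantsHypothesis.ValiantsHypothesis.Theorems.KPlusLogSqLawStepSupStructure (step_sup_structure)
/-- THE EVENT-PAIR PRINCIPLE: two lines that compare one way at `u` and the other way at a later `v`, against the
order of their slopes, do not exist. -/
theorem two_point_sign (s b : ℕ → ℝ) (x y : ℕ) (u v : ℝ) (huv : u < v) (hu : b y + s y * u ≤ b x + s x * u)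
    (hv : b x + s x * v ≤ b y + s y * v) (hs : s y < s x) : False := by
  have key : (s x - s y) * (v - u) = s x * v - s x * u - s y * v + s y * u := by ring
  have pos : 0 < (s x - s y) * (v - u) := mul_pos (by linarith) (by linarith)
  linarith

/-- Class swap `S ↦ -S`, class-generic: separation for `up` is separation of `-S` for the complementary class. -/
theorem sep_cneg (up : ℕ → Prop) (s b : ℕ → ℝ) (lo hi : ℕ) (θ : ℝ)
    (h : ∀ e o : ℕ, lo ≤ e → e ≤ hi → lo ≤ o → o ≤ hi → up e → ¬ up o → b o + s o * θ < b e + s e * θ) :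
    ∀ e o : ℕ, lo ≤ e → e ≤ hi → lo ≤ o → o ≤ hi → ¬ up e → ¬ ¬ up o → -b o + -s o * θ < -b e + -s e * θ := by
  intro e o h1 h2 h3 h4 he ho
  have := h o e h3 h4 h1 h2 (not_not.mp ho) he
  have r1 : -s o * θ = -(s o * θ) := by ring
  have r2 : -s e * θ = -(s e * θ) := by ring
  linarith

/-- Inverse of `sep_cneg`. -/
theorem sep_of_cneg (up : ℕ → Prop) (s b : ℕ → ℝ) (lo hi : ℕ) (θ : ℝ)
    (h : ∀ e o : ℕ, lo ≤ e → e ≤ hi → lo ≤ o → o ≤ hi → ¬ up e → ¬ ¬ up o →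
      -b o + -s o * θ < -b e + -s e * θ) :
    ∀ e o : ℕ, lo ≤ e → e ≤ hi → lo ≤ o → o ≤ hi → up e → ¬ up o → b o + s o * θ < b e + s e * θ := by
  intro e o h1 h2 h3 h4 he ho
  have := h o e h3 h4 h1 h2 ho (not_not_intro he)
  have r1 : -s o * θ = -(s o * θ) := by ring
  have r2 : -s e * θ = -(s e * θ) := by ring
  linarith

/-- Class swap composed with reflection, `S_t(θ) ↦ -S_t(-θ)`, class-generic (slopes kept). -/
theorem sep_cnegrefl (up : ℕ → Prop) (s b : ℕ → ℝ) (lo hi : ℕ) (θ : ℝ)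
    (h : ∀ e o : ℕ, lo ≤ e → e ≤ hi → lo ≤ o → o ≤ hi → up e → ¬ up o → b o + s o * θ < b e + s e * θ) :
    ∀ e o : ℕ, lo ≤ e → e ≤ hi → lo ≤ o → o ≤ hi → ¬ up e → ¬ ¬ up o → -b o + s o * -θ < -b e + s e * -θ := by
  intro e o h1 h2 h3 h4 he ho
  have := h o e h3 h4 h1 h2 (not_not.mp ho) he
  have r1 : s o * -θ = -(s o * θ) := by ring
  have r2 : s e * -θ = -(s e * θ) := by ring
  linarith

/-- Inverse direction of `sep_cnegrefl`. -/
theorem sep_of_cnegrefl (up : ℕ → Prop) (s b : ℕ → ℝ) (lo hi : ℕ) (θ : ℝ)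
    (h : ∀ e o : ℕ, lo ≤ e → e ≤ hi → lo ≤ o → o ≤ hi → ¬ up e → ¬ ¬ up o →
      -b o + s o * θ < -b e + s e * θ) :
    ∀ e o : ℕ, lo ≤ e → e ≤ hi → lo ≤ o → o ≤ hi → up e → ¬ up o → b o + s o * -θ < b e + s e * -θ := by
  intro e o h1 h2 h3 h4 he ho
  have := h o e h3 h4 h1 h2 ho (not_not_intro he)
  have r1 : s o * -θ = -(s o * θ) := by ring
  have r2 : s e * -θ = -(s e * θ) := by ring
  linarith

/-- Binding event of a LOWER leaving line, row moving RIGHT: if row `j` steps to the right and its outer lines `j`,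
`j+d+1` are lower, then at some `r ≥ T[j, j+d]` the line `j` is the top lower line of `[j, j+d]`. -/
theorem lower_leaving_event_right (up : ℕ → Prop) (s b : ℕ → ℝ) (j d : ℕ) (hlow0 : ¬ up j)
    (hlow1 : ¬ up (j + d + 1)) (hup : ∃ e : ℕ, j + 1 ≤ e ∧ e ≤ j + d ∧ up e)
    (hA : ∃ θ : ℝ, ∀ e o : ℕ, j ≤ e → e ≤ j + d → j ≤ o → o ≤ j + d → up e → ¬ up o →
      b o + s o * θ < b e + s e * θ)
    (hB : ∃ θ : ℝ, ∀ e o : ℕ, j + 1 ≤ e → e ≤ j + d + 1 → j + 1 ≤ o → o ≤ j + d + 1 → up e → ¬ up o →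
      b o + s o * θ < b e + s e * θ)
    (hord : ∀ θ θ' : ℝ, (∀ e o : ℕ, j ≤ e → e ≤ j + d → j ≤ o → o ≤ j + d → up e → ¬ up o →
      b o + s o * θ < b e + s e * θ) → (∀ e o : ℕ, j + 1 ≤ e → e ≤ j + d + 1 → j + 1 ≤ o → o ≤ j + d + 1 →
      up e → ¬ up o → b o + s o * θ' < b e + s e * θ') → θ < θ') :
    ∃ r : ℝ, (∀ θ : ℝ, (∀ e o : ℕ, j ≤ e → e ≤ j + d → j ≤ o → o ≤ j + d → up e → ¬ up o →
      b o + s o * θ < b e + s e * θ) → θ ≤ r) ∧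
      (∀ o : ℕ, j ≤ o → o ≤ j + d → ¬ up o → b o + s o * r ≤ b j + s j * r) := by
  obtain ⟨θA, hθA⟩ := hA
  obtain ⟨θB, hθB⟩ := hB
  obtain ⟨e1, he1a, he1b, he1c⟩ := hup
  obtain ⟨r, q, hq1, hq2, hqc, -, -, heq, hcmp, hTle, -, -⟩ :=
    step_sup_structure (fun n => ¬ up n) (fun t => -s t) (fun t => -b t) j d hlow0 hlow1
      ⟨e1, he1a, he1b, not_not_intro he1c⟩
      ⟨θA, sep_cneg up s b j (j + d) θA hθA⟩ ⟨θB, sep_cneg up s b (j + 1) (j + d + 1) θB hθB⟩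
      (fun θ h => lt_irrefl θ (hord θ θ (sep_of_cneg up s b j (j + d) θ h.1)
        (sep_of_cneg up s b (j + 1) (j + d + 1) θ h.2)))
      (fun θ θ' hθ hθ' => hord θ θ' (sep_of_cneg up s b j (j + d) θ hθ)
        (sep_of_cneg up s b (j + 1) (j + d + 1) θ' hθ'))
  refine ⟨r, fun θ hθ => hTle θ (sep_cneg up s b j (j + d) θ hθ), fun o ho1 ho2 hoc => ?_⟩
  -- `S_o ≤ S_q` (weak separation, `q` upper) and `S_q = S_j` (binding)
  have h1 := hcmp o q ho1 ho2 (by omega) hq2 hoc hqc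
  have e1 : -b q + -s q * r = -b j + -s j * r := heq
  have e2 : -b q + -s q * r ≤ -b o + -s o * r := h1
  have r1 : -s q * r = -(s q * r) := by ring
  have r2 : -s j * r = -(s j * r) := by ring
  have r3 : -s o * r = -(s o * r) := by ring
  linarith

/-- Binding event of a LOWER leaving line, row moving LEFT: if row `j` steps to the left and its outer lines are lower,
then at some `r` that is `≥` every strict lower bound of `T[j, j+d]` (namely `r = inf T[j, j+d]`) the line `j` is
the top lower line of `[j, j+d]`. -/
theorem lower_leaving_event_left (up : ℕ → Prop) (s b : ℕ → ℝ) (j d : ℕ) (hlow0 : ¬ up j)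
    (hlow1 : ¬ up (j + d + 1)) (hup : ∃ e : ℕ, j + 1 ≤ e ∧ e ≤ j + d ∧ up e)
    (hA : ∃ θ : ℝ, ∀ e o : ℕ, j ≤ e → e ≤ j + d → j ≤ o → o ≤ j + d → up e → ¬ up o →
      b o + s o * θ < b e + s e * θ)
    (hB : ∃ θ : ℝ, ∀ e o : ℕ, j + 1 ≤ e → e ≤ j + d + 1 → j + 1 ≤ o → o ≤ j + d + 1 → up e → ¬ up o →
      b o + s o * θ < b e + s e * θ)
    (hord : ∀ θ θ' : ℝ, (∀ e o : ℕ, j ≤ e → e ≤ j + d → j ≤ o → o ≤ j + d → up e → ¬ up o →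
      b o + s o * θ < b e + s e * θ) → (∀ e o : ℕ, j + 1 ≤ e → e ≤ j + d + 1 → j + 1 ≤ o → o ≤ j + d + 1 →
      up e → ¬ up o → b o + s o * θ' < b e + s e * θ') → θ' < θ) :
    ∃ r : ℝ, (∀ m : ℝ, (∀ θ : ℝ, (∀ e o : ℕ, j ≤ e → e ≤ j + d → j ≤ o → o ≤ j + d → up e → ¬ up o →
      b o + s o * θ < b e + s e * θ) → m < θ) → m ≤ r) ∧
      (∀ o : ℕ, j ≤ o → o ≤ j + d → ¬ up o → b o + s o * r ≤ b j + s j * r) := by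
  obtain ⟨θA, hθA⟩ := hA
  obtain ⟨θB, hθB⟩ := hB
  obtain ⟨e1, he1a, he1b, he1c⟩ := hup
  -- `S_t(θ) ↦ -S_t(-θ)`: classes swapped, slopes kept, the row now moves right
  obtain ⟨r, q, hq1, hq2, hqc, -, -, heq, hcmp, -, hnear, -⟩ :=
    step_sup_structure (fun n => ¬ up n) s (fun t => -b t) j d hlow0 hlow1
      ⟨e1, he1a, he1b, not_not_intro he1c⟩
      ⟨-θA, sep_cnegrefl up s b j (j + d) θA hθA⟩ ⟨-θB, sep_cnegrefl up s b (j + 1) (j + d + 1) θB hθB⟩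
      (fun θ h => by
        have := hord (-θ) (-θ) (sep_of_cnegrefl up s b j (j + d) θ h.1)
          (sep_of_cnegrefl up s b (j + 1) (j + d + 1) θ h.2)
        exact lt_irrefl _ this)
      (fun θ θ' hθ hθ' => by
        have := hord (-θ) (-θ') (sep_of_cnegrefl up s b j (j + d) θ hθ)
          (sep_of_cnegrefl up s b (j + 1) (j + d + 1) θ' hθ')
        linarith)
  refine ⟨-r, fun m hm => ?_, fun o ho1 ho2 hoc => ?_⟩
  · -- `-m` bounds the reflected separation set from above, and `r` is its least upper bound
    refine le_of_not_gt fun hcon => ?_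
    obtain ⟨θ, hθ, hlt⟩ := hnear (m + r) (by linarith)
    have h1 := hm (-θ) (sep_of_cnegrefl up s b j (j + d) θ hθ)
    linarith
  · have h1 := hcmp o q ho1 ho2 (by omega) hq2 hoc hqc
    have e1 : -b q + s q * r = -b j + s j * r := heq
    have e2 : -b q + s q * r ≤ -b o + s o * r := h1
    have r1 : s q * -r = -(s q * r) := by ring
    have r2 : s j * -r = -(s j * r) := by ring
    have r3 : s o * -r = -(s o * r) := by ring
    linarith

/-- CROSS LAW, class-generic core: row `i` steps to the right (outer lines upper), `T[i,i+d] < T[i+1,i+d+1] <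
T[i+2,i+d+2]`, and at some `r₃ ≥ T[i+2,i+d+2]` the lower line `i+3` is the top lower line of `[i+3, i+d+3]`; then
not every admissible partner `p` of row `i` has `p ≥ i+4` and `s (i+3) < s p`. -/
theorem cross_law_core (up : ℕ → Prop) (s b : ℕ → ℝ) (i d : ℕ) (hd : 3 ≤ d) (hup0 : up i)
    (hup1 : up (i + d + 1)) (hlow3 : ¬ up (i + 3))
    (hlow0 : ∃ o : ℕ, i + 1 ≤ o ∧ o ≤ i + d ∧ ¬ up o)
    (hA0 : ∃ θ : ℝ, ∀ e o : ℕ, i ≤ e → e ≤ i + d → i ≤ o → o ≤ i + d → up e → ¬ up o →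
      b o + s o * θ < b e + s e * θ)
    (hB0 : ∃ θ : ℝ, ∀ e o : ℕ, i + 1 ≤ e → e ≤ i + d + 1 → i + 1 ≤ o → o ≤ i + d + 1 → up e → ¬ up o →
      b o + s o * θ < b e + s e * θ)
    (hord0 : ∀ θ θ' : ℝ, (∀ e o : ℕ, i ≤ e → e ≤ i + d → i ≤ o → o ≤ i + d → up e → ¬ up o →
      b o + s o * θ < b e + s e * θ) → (∀ e o : ℕ, i + 1 ≤ e → e ≤ i + d + 1 → i + 1 ≤ o → o ≤ i + d + 1 →
      up e → ¬ up o → b o + s o * θ' < b e + s e * θ') → θ < θ')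
    (hord1 : ∀ θ θ' : ℝ, (∀ e o : ℕ, i + 1 ≤ e → e ≤ i + d + 1 → i + 1 ≤ o → o ≤ i + d + 1 → up e → ¬ up o →
      b o + s o * θ < b e + s e * θ) → (∀ e o : ℕ, i + 2 ≤ e → e ≤ i + d + 2 → i + 2 ≤ o → o ≤ i + d + 2 →
      up e → ¬ up o → b o + s o * θ' < b e + s e * θ') → θ < θ')
    (hA2 : ∃ θ : ℝ, ∀ e o : ℕ, i + 2 ≤ e → e ≤ i + d + 2 → i + 2 ≤ o → o ≤ i + d + 2 → up e → ¬ up o →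
      b o + s o * θ < b e + s e * θ)
    (h3 : ∃ r : ℝ, (∀ θ : ℝ, (∀ e o : ℕ, i + 2 ≤ e → e ≤ i + d + 2 → i + 2 ≤ o → o ≤ i + d + 2 → up e →
      ¬ up o → b o + s o * θ < b e + s e * θ) → θ ≤ r) ∧
      (∀ o : ℕ, i + 3 ≤ o → o ≤ i + d + 3 → ¬ up o → b o + s o * r ≤ b (i + 3) + s (i + 3) * r))
    (hJ : ∀ p : ℕ, i + 1 ≤ p → p ≤ i + d → ¬ up p → s i < s p → s p < s (i + d + 1) →
      i + 4 ≤ p ∧ s (i + 3) < s p) :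
    False := by
  obtain ⟨r0, p, hp1, hp2, hpl, hsp1, hsp2, heq0, hcmp0, -, -, hBgt0⟩ :=
    step_sup_structure up s b i d hup0 hup1 hlow0 hA0 hB0 (fun θ h => lt_irrefl θ (hord0 θ θ h.1 h.2)) hord0
  obtain ⟨hp4, hs3⟩ := hJ p hp1 hp2 hpl hsp1 hsp2
  obtain ⟨r3, h3le, h3top⟩ := h3
  obtain ⟨θ1, hθ1⟩ := hB0
  obtain ⟨θ2, hθ2⟩ := hA2
  have h01 : r0 < θ1 := hBgt0 θ1 hθ1
  have h12 : θ1 < θ2 := hord1 θ1 θ2 hθ1 hθ2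
  have h23 : θ2 ≤ r3 := h3le θ2 hθ2
  -- at `r0`: `S_{i+3} ≤ S_i = S_p`; at `r3`: `S_p ≤ S_{i+3}`
  have hu : b (i + 3) + s (i + 3) * r0 ≤ b i + s i * r0 :=
    hcmp0 i (i + 3) le_rfl (by omega) (by omega) (by omega) hup0 hlow3
  have hv : b p + s p * r3 ≤ b (i + 3) + s (i + 3) * r3 := h3top p (by omega) (by omega) hpl
  exact two_point_sign s b p (i + 3) r0 r3 (by linarith) (by linarith) hv hs3

/-- CROSS LAW J1, line `i` even, rows `i, i+1, i+2` moving right, row `i+3` moving RIGHT. -/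
theorem cross_law_even_same (s b : ℕ → ℝ) (i d : ℕ) (hi : Even i) (hd : Odd d) (hd3 : 3 ≤ d)
    (hA0 : ∃ θ : ℝ, ∀ e o : ℕ, i ≤ e → e ≤ i + d → i ≤ o → o ≤ i + d → Even e → Odd o →
      b o + s o * θ < b e + s e * θ)
    (hB0 : ∃ θ : ℝ, ∀ e o : ℕ, i + 1 ≤ e → e ≤ i + d + 1 → i + 1 ≤ o → o ≤ i + d + 1 → Even e → Odd o →
      b o + s o * θ < b e + s e * θ)
    (hord0 : ∀ θ θ' : ℝ, (∀ e o : ℕ, i ≤ e → e ≤ i + d → i ≤ o → o ≤ i + d → Even e → Odd o →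
      b o + s o * θ < b e + s e * θ) → (∀ e o : ℕ, i + 1 ≤ e → e ≤ i + d + 1 → i + 1 ≤ o → o ≤ i + d + 1 →
      Even e → Odd o → b o + s o * θ' < b e + s e * θ') → θ < θ')
    (hord1 : ∀ θ θ' : ℝ, (∀ e o : ℕ, i + 1 ≤ e → e ≤ i + d + 1 → i + 1 ≤ o → o ≤ i + d + 1 → Even e →
      Odd o → b o + s o * θ < b e + s e * θ) → (∀ e o : ℕ, i + 2 ≤ e → e ≤ i + d + 2 → i + 2 ≤ o →
      o ≤ i + d + 2 → Even e → Odd o → b o + s o * θ' < b e + s e * θ') → θ < θ')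
    (hA2 : ∃ θ : ℝ, ∀ e o : ℕ, i + 2 ≤ e → e ≤ i + d + 2 → i + 2 ≤ o → o ≤ i + d + 2 → Even e → Odd o →
      b o + s o * θ < b e + s e * θ)
    (hord2 : ∀ θ θ' : ℝ, (∀ e o : ℕ, i + 2 ≤ e → e ≤ i + d + 2 → i + 2 ≤ o → o ≤ i + d + 2 → Even e →
      Odd o → b o + s o * θ < b e + s e * θ) → (∀ e o : ℕ, i + 3 ≤ e → e ≤ i + d + 3 → i + 3 ≤ o →
      o ≤ i + d + 3 → Even e → Odd o → b o + s o * θ' < b e + s e * θ') → θ < θ')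
    (hA3 : ∃ θ : ℝ, ∀ e o : ℕ, i + 3 ≤ e → e ≤ i + d + 3 → i + 3 ≤ o → o ≤ i + d + 3 → Even e → Odd o →
      b o + s o * θ < b e + s e * θ)
    (hB3 : ∃ θ : ℝ, ∀ e o : ℕ, i + 4 ≤ e → e ≤ i + d + 4 → i + 4 ≤ o → o ≤ i + d + 4 → Even e → Odd o →
      b o + s o * θ < b e + s e * θ)
    (hord3 : ∀ θ θ' : ℝ, (∀ e o : ℕ, i + 3 ≤ e → e ≤ i + d + 3 → i + 3 ≤ o → o ≤ i + d + 3 → Even e →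
      Odd o → b o + s o * θ < b e + s e * θ) → (∀ e o : ℕ, i + 4 ≤ e → e ≤ i + d + 4 → i + 4 ≤ o →
      o ≤ i + d + 4 → Even e → Odd o → b o + s o * θ' < b e + s e * θ') → θ < θ')
    (hJ : ∀ p : ℕ, i + 1 ≤ p → p ≤ i + d → Odd p → s i < s p → s p < s (i + d + 1) →
      i + 4 ≤ p ∧ s (i + 3) < s p) :
    False := by
  have hi1 : ¬ Even (i + 1) := by
    obtain ⟨k, hk⟩ := hi
    exact Nat.not_even_iff_odd.mpr ⟨k, by omega⟩
  have hi3 : ¬ Even (i + 3) := by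
    obtain ⟨k, hk⟩ := hi
    exact Nat.not_even_iff_odd.mpr ⟨k + 1, by omega⟩
  have hup1 : Even (i + d + 1) := by
    obtain ⟨k, hk⟩ := hi
    obtain ⟨l, hl⟩ := hd
    exact ⟨k + l + 1, by omega⟩
  have hlow4 : ¬ Even (i + 3 + d + 1) := by
    obtain ⟨k, hk⟩ := hi
    obtain ⟨l, hl⟩ := hd
    exact Nat.not_even_iff_odd.mpr ⟨k + l + 2, by omega⟩
  have hup4 : Even (i + 4) := by
    obtain ⟨k, hk⟩ := hi
    exact ⟨k + 2, by omega⟩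
  obtain ⟨θC, hθC⟩ := hA3
  obtain ⟨θD, hθD⟩ := hB3
  -- the binding event of the lower line `i + 3` (windows rewritten from `i + 3 + d` to `i + d + 3`)
  obtain ⟨r3, h3le, h3top⟩ := lower_leaving_event_right (fun n => Even n) s b (i + 3) d hi3 hlow4
    ⟨i + 4, by omega, by omega, hup4⟩
    ⟨θC, fun e o h1 h2 h3 h4 he ho => hθC e o h1 (by omega) h3 (by omega) he (Nat.not_even_iff_odd.mp ho)⟩
    ⟨θD, fun e o h1 h2 h3 h4 he ho => hθD e o (by omega) (by omega) (by omega) (by omega) he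
      (Nat.not_even_iff_odd.mp ho)⟩
    (fun θ θ' hθ hθ' => hord3 θ θ'
      (fun e o h1 h2 h3 h4 he ho => hθ e o h1 (by omega) h3 (by omega) he (Nat.not_even_iff_odd.mpr ho))
      (fun e o h1 h2 h3 h4 he ho => hθ' e o (by omega) (by omega) (by omega) (by omega) he
        (Nat.not_even_iff_odd.mpr ho)))
  obtain ⟨θA, hθA⟩ := hA0
  obtain ⟨θB, hθB⟩ := hB0
  obtain ⟨θ2, hθ2⟩ := hA2
  refine cross_law_core (fun n => Even n) s b i d hd3 hi hup1 hi3 ⟨i + 1, le_rfl, by omega, hi1⟩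
    ⟨θA, fun e o h1 h2 h3 h4 he ho => hθA e o h1 h2 h3 h4 he (Nat.not_even_iff_odd.mp ho)⟩
    ⟨θB, fun e o h1 h2 h3 h4 he ho => hθB e o h1 h2 h3 h4 he (Nat.not_even_iff_odd.mp ho)⟩
    (fun θ θ' hθ hθ' => hord0 θ θ'
      (fun e o h1 h2 h3 h4 he ho => hθ e o h1 h2 h3 h4 he (Nat.not_even_iff_odd.mpr ho))
      (fun e o h1 h2 h3 h4 he ho => hθ' e o h1 h2 h3 h4 he (Nat.not_even_iff_odd.mpr ho)))
    (fun θ θ' hθ hθ' => hord1 θ θ'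
      (fun e o h1 h2 h3 h4 he ho => hθ e o h1 h2 h3 h4 he (Nat.not_even_iff_odd.mpr ho))
      (fun e o h1 h2 h3 h4 he ho => hθ' e o h1 h2 h3 h4 he (Nat.not_even_iff_odd.mpr ho)))
    ⟨θ2, fun e o h1 h2 h3 h4 he ho => hθ2 e o h1 h2 h3 h4 he (Nat.not_even_iff_odd.mp ho)⟩
    ⟨r3, fun θ hθ => ?_, fun o h1 h2 ho => h3top o h1 (by omega) ho⟩
    (fun p g1 g2 gp g3 g4 => hJ p g1 g2 (Nat.not_even_iff_odd.mp gp) g3 g4)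
  -- `T[i+2, i+d+2] ≤ r3`: a point of `T[i+3, i+d+3]` lies between
  have h23 : θ < θC := hord2 θ θC (fun e o h1 h2 h3 h4 he ho => hθ e o h1 h2 h3 h4 he
    (Nat.not_even_iff_odd.mpr ho)) hθC
  have hC : θC ≤ r3 := h3le θC (fun e o h1 h2 h3 h4 he ho => hθC e o h1 (by omega) h3 (by omega) he
    (Nat.not_even_iff_odd.mp ho))
  linarith

/-- CROSS LAW J1, line `i` even, rows `i, i+1, i+2` moving right, row `i+3` moving LEFT. -/
theorem cross_law_even_opp (s b : ℕ → ℝ) (i d : ℕ) (hi : Even i) (hd : Odd d) (hd3 : 3 ≤ d)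
    (hA0 : ∃ θ : ℝ, ∀ e o : ℕ, i ≤ e → e ≤ i + d → i ≤ o → o ≤ i + d → Even e → Odd o →
      b o + s o * θ < b e + s e * θ)
    (hB0 : ∃ θ : ℝ, ∀ e o : ℕ, i + 1 ≤ e → e ≤ i + d + 1 → i + 1 ≤ o → o ≤ i + d + 1 → Even e → Odd o →
      b o + s o * θ < b e + s e * θ)
    (hord0 : ∀ θ θ' : ℝ, (∀ e o : ℕ, i ≤ e → e ≤ i + d → i ≤ o → o ≤ i + d → Even e → Odd o →
      b o + s o * θ < b e + s e * θ) → (∀ e o : ℕ, i + 1 ≤ e → e ≤ i + d + 1 → i + 1 ≤ o → o ≤ i + d + 1 →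
      Even e → Odd o → b o + s o * θ' < b e + s e * θ') → θ < θ')
    (hord1 : ∀ θ θ' : ℝ, (∀ e o : ℕ, i + 1 ≤ e → e ≤ i + d + 1 → i + 1 ≤ o → o ≤ i + d + 1 → Even e →
      Odd o → b o + s o * θ < b e + s e * θ) → (∀ e o : ℕ, i + 2 ≤ e → e ≤ i + d + 2 → i + 2 ≤ o →
      o ≤ i + d + 2 → Even e → Odd o → b o + s o * θ' < b e + s e * θ') → θ < θ')
    (hA2 : ∃ θ : ℝ, ∀ e o : ℕ, i + 2 ≤ e → e ≤ i + d + 2 → i + 2 ≤ o → o ≤ i + d + 2 → Even e → Odd o →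
      b o + s o * θ < b e + s e * θ)
    (hord2 : ∀ θ θ' : ℝ, (∀ e o : ℕ, i + 2 ≤ e → e ≤ i + d + 2 → i + 2 ≤ o → o ≤ i + d + 2 → Even e →
      Odd o → b o + s o * θ < b e + s e * θ) → (∀ e o : ℕ, i + 3 ≤ e → e ≤ i + d + 3 → i + 3 ≤ o →
      o ≤ i + d + 3 → Even e → Odd o → b o + s o * θ' < b e + s e * θ') → θ < θ')
    (hA3 : ∃ θ : ℝ, ∀ e o : ℕ, i + 3 ≤ e → e ≤ i + d + 3 → i + 3 ≤ o → o ≤ i + d + 3 → Even e → Odd o →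
      b o + s o * θ < b e + s e * θ)
    (hB3 : ∃ θ : ℝ, ∀ e o : ℕ, i + 4 ≤ e → e ≤ i + d + 4 → i + 4 ≤ o → o ≤ i + d + 4 → Even e → Odd o →
      b o + s o * θ < b e + s e * θ)
    (hord3 : ∀ θ θ' : ℝ, (∀ e o : ℕ, i + 3 ≤ e → e ≤ i + d + 3 → i + 3 ≤ o → o ≤ i + d + 3 → Even e →
      Odd o → b o + s o * θ < b e + s e * θ) → (∀ e o : ℕ, i + 4 ≤ e → e ≤ i + d + 4 → i + 4 ≤ o →
      o ≤ i + d + 4 → Even e → Odd o → b o + s o * θ' < b e + s e * θ') → θ' < θ)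
    (hJ : ∀ p : ℕ, i + 1 ≤ p → p ≤ i + d → Odd p → s i < s p → s p < s (i + d + 1) →
      i + 4 ≤ p ∧ s (i + 3) < s p) :
    False := by
  have hi1 : ¬ Even (i + 1) := by
    obtain ⟨k, hk⟩ := hi
    exact Nat.not_even_iff_odd.mpr ⟨k, by omega⟩
  have hi3 : ¬ Even (i + 3) := by
    obtain ⟨k, hk⟩ := hi
    exact Nat.not_even_iff_odd.mpr ⟨k + 1, by omega⟩
  have hup1 : Even (i + d + 1) := by
    obtain ⟨k, hk⟩ := hi
    obtain ⟨l, hl⟩ := hd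
    exact ⟨k + l + 1, by omega⟩
  have hlow4 : ¬ Even (i + 3 + d + 1) := by
    obtain ⟨k, hk⟩ := hi
    obtain ⟨l, hl⟩ := hd
    exact Nat.not_even_iff_odd.mpr ⟨k + l + 2, by omega⟩
  have hup4 : Even (i + 4) := by
    obtain ⟨k, hk⟩ := hi
    exact ⟨k + 2, by omega⟩
  obtain ⟨θC, hθC⟩ := hA3
  obtain ⟨θD, hθD⟩ := hB3
  obtain ⟨r3, h3ge, h3top⟩ := lower_leaving_event_left (fun n => Even n) s b (i + 3) d hi3 hlow4
    ⟨i + 4, by omega, by omega, hup4⟩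
    ⟨θC, fun e o h1 h2 h3 h4 he ho => hθC e o h1 (by omega) h3 (by omega) he (Nat.not_even_iff_odd.mp ho)⟩
    ⟨θD, fun e o h1 h2 h3 h4 he ho => hθD e o (by omega) (by omega) (by omega) (by omega) he
      (Nat.not_even_iff_odd.mp ho)⟩
    (fun θ θ' hθ hθ' => hord3 θ θ'
      (fun e o h1 h2 h3 h4 he ho => hθ e o h1 (by omega) h3 (by omega) he (Nat.not_even_iff_odd.mpr ho))
      (fun e o h1 h2 h3 h4 he ho => hθ' e o (by omega) (by omega) (by omega) (by omega) he
        (Nat.not_even_iff_odd.mpr ho)))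
  obtain ⟨θA, hθA⟩ := hA0
  obtain ⟨θB, hθB⟩ := hB0
  obtain ⟨θ2, hθ2⟩ := hA2
  refine cross_law_core (fun n => Even n) s b i d hd3 hi hup1 hi3 ⟨i + 1, le_rfl, by omega, hi1⟩
    ⟨θA, fun e o h1 h2 h3 h4 he ho => hθA e o h1 h2 h3 h4 he (Nat.not_even_iff_odd.mp ho)⟩
    ⟨θB, fun e o h1 h2 h3 h4 he ho => hθB e o h1 h2 h3 h4 he (Nat.not_even_iff_odd.mp ho)⟩
    (fun θ θ' hθ hθ' => hord0 θ θ'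
      (fun e o h1 h2 h3 h4 he ho => hθ e o h1 h2 h3 h4 he (Nat.not_even_iff_odd.mpr ho))
      (fun e o h1 h2 h3 h4 he ho => hθ' e o h1 h2 h3 h4 he (Nat.not_even_iff_odd.mpr ho)))
    (fun θ θ' hθ hθ' => hord1 θ θ'
      (fun e o h1 h2 h3 h4 he ho => hθ e o h1 h2 h3 h4 he (Nat.not_even_iff_odd.mpr ho))
      (fun e o h1 h2 h3 h4 he ho => hθ' e o h1 h2 h3 h4 he (Nat.not_even_iff_odd.mpr ho)))
    ⟨θ2, fun e o h1 h2 h3 h4 he ho => hθ2 e o h1 h2 h3 h4 he (Nat.not_even_iff_odd.mp ho)⟩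
    ⟨r3, fun θ hθ => ?_, fun o h1 h2 ho => h3top o h1 (by omega) ho⟩
    (fun p g1 g2 gp g3 g4 => hJ p g1 g2 (Nat.not_even_iff_odd.mp gp) g3 g4)
  -- `θ ∈ T[i+2, i+d+2]` is a strict lower bound of `T[i+3, i+d+3]`, hence `θ ≤ r3 = inf T[i+3, i+d+3]`
  exact h3ge θ (fun θ' hθ' => hord2 θ θ' (fun e o h1 h2 h3 h4 he ho => hθ e o h1 h2 h3 h4 he
    (Nat.not_even_iff_odd.mpr ho)) (fun e o h1 h2 h3 h4 he ho => hθ' e o h1 (by omega) h3 (by omega) he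
    (Nat.not_even_iff_odd.mpr ho)))

end Summit.ValiantsHypothesis.ValiantsHypothesis.Theorems.KPlusLogSqLawStepCross
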